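import Mathlib
import Literature.NumberTheory.LFunctions.Zhang2022.Section11AFETailTools
import HarnessLib

/-!
# Zhang (2022) §11, proof of Lemma 11.2 for `χψ` — (6.2) for `χψ` PROVED: the reflected tail
# `n ≥ P₁` contributes `≪ exp{−𝓛¹⁰/16}` (`tailSmall11_holds : TailSmall11`)

Topic `Literature/NumberTheory/LFunctions/Zhang2022` (Landau–Siegel audit tree; verdict-neutral).
Y. Zhang, *Discrete mean estimates and the Landau–Siegel zero*, arXiv:2211.02515v1 (2022)
[Zhang2022LandauSiegel] — **an unrefereed manuscript under adjudication** (campaign D-0069; nothing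
here bears on Theorems 1–2 or on Landau–Siegel zeros). Companion of `Section11AFEObjects` (the node
`Z22:§11.u024` = the first display of the proof of Lemma 11.2, "in a way similar to the proof of
Lemma 6.1", and its typed sub-steps) and of `Section11AFETailTools`.

DAG node served: `Z22:§11.u024`, sub-step (d) `Section11AFE.TailSmall11` = the §6 display
`Z22:(6.2)` (pp. 31–32, tex L1729–1754) for `χψ (mod Dp)`, `X = P^z`, `N = P₁`:
"`∫_{(−1)} Z(s+w,χψ)(Σ_{n≥P₁}χψ̄(n)n^{−(1−s−w)})X^wω₁(w)dw/w ≪ ε`". PROVED (`tailSmall11_holds`,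
`c = 1/16`): the line `u = −1` is split at `|v| = 𝓛²⁰`; the outer half-lines are `≪ ε` by the
"trivial bound for `ω₁(w)`" (`|ω₁(−1+iv)| = e^{(1−v²)/4𝓛³⁰}`, Gaussian tail
`Section11AFE.gauss_tail_quad_le`, `|Z(−1/2+iτ,χψ)| ≤ G(Dp)²(|τ|+2)²` uniformly —
`StripGrowth.exists_norm_Zfac_le`); the window is moved to `u = −𝓛⁹` (`rect_integrandTail`), where
`|Z(s+w,χψ)X^w·tail| ≤ 12√P₁(Dp(t+v)/(2πP^zP₁))^{𝓛⁹} ≤ 12√P₁e^{−𝓛¹⁰}`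
(`norm_integrandTail_inner_le`), the horizontal segments carrying `|ω₁(u ± i𝓛²⁰)| ≤ e^{1/4−𝓛¹⁰/4}`.
Theorem-only; 0 new definitions, 0 new facts. With `Section11AFEAssembly.step11u024e_of_tail_window`
this leaves the repaired display `Step11u024e` resting on (6.5) for `χψ` (`WindowMove11`) alone.

## References

* Y. Zhang, arXiv:2211.02515v1 (2022), §6 proof of Lemma 6.1, (6.2) pp. 31–32; §11 Lemma 11.2
  p. 65. [cite: Zhang2022LandauSiegel, §6 (6.2); §11 Lemma 11.2]
* H. L. Montgomery, R. C. Vaughan, *Multiplicative Number Theory I*, CUP 2007, §10.1 Cor. 10.10.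
  [cite: MontgomeryVaughan2007, §10.1 Cor. 10.10]
-/

noncomputable section

open Complex Real ComplexConjugate MeasureTheory Set Filter Topology

namespace Literature.NumberTheory.LFunctions.Zhang2022.Section11AFE

open Skeleton GaussWeight Section6Statements

section BlockDFinal

variable {D : ℕ} [NeZero D] (χ : DirichletCharacter ℂ D) (x : Chr D)

/-! ## §1. Real bookkeeping (`𝓛 ≥ 64`) -/

omit [NeZero D] in
/-- `ℓⁿ ≤ e^{nℓ}` for `ℓ ≥ 0`. [folklore] -/
private theorem pow_le_exp_nat_mul {ℓ : ℝ} (hℓ : 0 ≤ ℓ) (n : ℕ) : ℓ ^ n ≤ Real.exp (n * ℓ) := by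
  rw [Real.exp_nat_mul]
  exact pow_le_pow_left₀ hℓ (by linarith [Real.add_one_le_exp ℓ]) n

omit [NeZero D] in
/-- A numeral is below an exponential: `m ≤ e^{m}` (crude). [folklore] -/
private theorem nat_le_exp (m : ℕ) : (m : ℝ) ≤ Real.exp m := by
  linarith [Real.add_one_le_exp (m : ℝ)]

omit [NeZero D] in
/-- The horizontal segments: `𝓛⁹·12√P₁·e^{1/4−𝓛¹⁰/4} ≤ e^{−𝓛¹⁰/8}` (`√P₁ = e^{0.252𝓛⁹}`, `𝓛 ≥ 64`).
[cite: Zhang2022LandauSiegel, §6 (6.2) p. 32] -/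
private theorem bound_horizontal {ℓ : ℝ} (hℓ : 64 ≤ ℓ) :
    ℓ ^ 9 * (12 * Real.exp (0.252 * ℓ ^ 9) * Real.exp (1 / 4 - ℓ ^ 10 / 4)) ≤
      Real.exp (-(ℓ ^ 10 / 8)) := by
  have hℓ0 : 0 ≤ ℓ := by linarith
  have h9 : ℓ ^ 9 ≤ Real.exp (9 * ℓ) := by exact_mod_cast pow_le_exp_nat_mul hℓ0 9
  have h12 : (12 : ℝ) ≤ Real.exp 12 := by exact_mod_cast nat_le_exp 12
  have h8 : (64 : ℝ) ^ 8 ≤ ℓ ^ 8 := pow_le_pow_left₀ (by norm_num) hℓ 8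
  calc ℓ ^ 9 * (12 * Real.exp (0.252 * ℓ ^ 9) * Real.exp (1 / 4 - ℓ ^ 10 / 4))
      ≤ Real.exp (9 * ℓ) * (Real.exp 12 * Real.exp (0.252 * ℓ ^ 9) * Real.exp (1 / 4 - ℓ ^ 10 / 4)) := by
        gcongr
    _ = Real.exp (9 * ℓ + 12 + 0.252 * ℓ ^ 9 + (1 / 4 - ℓ ^ 10 / 4)) := by
        simp only [Real.exp_add]; ring
    _ ≤ Real.exp (-(ℓ ^ 10 / 8)) := by
        rw [Real.exp_le_exp]
        have e9 : ℓ ^ 9 = ℓ ^ 8 * ℓ := by ring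
        have e10 : ℓ ^ 10 = ℓ ^ 8 * ℓ * ℓ := by ring
        rw [e9, e10]
        have hA : 0 ≤ ℓ ^ 8 * ℓ * (ℓ - 64) := by
          have : 0 ≤ ℓ ^ 8 * ℓ := by positivity
          exact mul_nonneg this (by linarith)
        have hB : (64 : ℝ) ^ 8 * ℓ ≤ ℓ ^ 8 * ℓ := mul_le_mul_of_nonneg_right h8 hℓ0
        nlinarith

omit [NeZero D] in
/-- The far vertical segment: `2𝓛²⁰·12√P₁·e^{−𝓛¹⁰}·e^{1/4} ≤ e^{−𝓛¹⁰/8}` (`𝓛 ≥ 64`).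
[cite: Zhang2022LandauSiegel, §6 (6.2) p. 32] -/
private theorem bound_vertical {ℓ : ℝ} (hℓ : 64 ≤ ℓ) :
    2 * ℓ ^ 20 * (12 * Real.exp (0.252 * ℓ ^ 9) * Real.exp (ℓ * -(ℓ ^ 9)) * Real.exp (1 / 4)) ≤
      Real.exp (-(ℓ ^ 10 / 8)) := by
  have hℓ0 : 0 ≤ ℓ := by linarith
  have h20 : ℓ ^ 20 ≤ Real.exp (20 * ℓ) := by exact_mod_cast pow_le_exp_nat_mul hℓ0 20
  have h24 : (24 : ℝ) ≤ Real.exp 24 := by exact_mod_cast nat_le_exp 24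
  have h8 : (64 : ℝ) ^ 8 ≤ ℓ ^ 8 := pow_le_pow_left₀ (by norm_num) hℓ 8
  calc 2 * ℓ ^ 20 * (12 * Real.exp (0.252 * ℓ ^ 9) * Real.exp (ℓ * -(ℓ ^ 9)) * Real.exp (1 / 4))
      = 24 * ℓ ^ 20 * (Real.exp (0.252 * ℓ ^ 9) * Real.exp (ℓ * -(ℓ ^ 9)) * Real.exp (1 / 4)) := by
        ring
    _ ≤ Real.exp 24 * Real.exp (20 * ℓ) *
          (Real.exp (0.252 * ℓ ^ 9) * Real.exp (ℓ * -(ℓ ^ 9)) * Real.exp (1 / 4)) := by gcongr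
    _ = Real.exp (24 + 20 * ℓ + 0.252 * ℓ ^ 9 + ℓ * -(ℓ ^ 9) + 1 / 4) := by
        simp only [Real.exp_add]; ring
    _ ≤ Real.exp (-(ℓ ^ 10 / 8)) := by
        rw [Real.exp_le_exp]
        have e9 : ℓ ^ 9 = ℓ ^ 8 * ℓ := by ring
        have e10 : ℓ ^ 10 = ℓ ^ 8 * ℓ * ℓ := by ring
        rw [e9, e10]
        have hA : 0 ≤ ℓ ^ 8 * ℓ * (ℓ - 64) := by
          have : 0 ≤ ℓ ^ 8 * ℓ := by positivity
          exact mul_nonneg this (by linarith)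
        have hB : (64 : ℝ) ^ 8 * ℓ ≤ ℓ ^ 8 * ℓ := mul_le_mul_of_nonneg_right h8 hℓ0
        nlinarith

omit [NeZero D] in
/-- The Gaussian-tail bracket of `gauss_tail_quad_le` at `β = 1/(4𝓛³⁰)`, `A ≤ 9𝓛⁵¹⁹`:
`(4/β)√(π/(β/4)) + 2A²√(π/(β/2)) ≤ 1856𝓛¹⁰⁵³` (`A ≤ 12𝓛⁵¹⁹`). [folklore] -/
private theorem bracket_le {ℓ A : ℝ} (hℓ : 1 ≤ ℓ) (hA0 : 0 ≤ A) (hA : A ≤ 12 * ℓ ^ 519) :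
    4 / (1 / (4 * ℓ ^ 30)) * Real.sqrt (π / ((1 / (4 * ℓ ^ 30)) / 4)) +
        2 * A ^ 2 * Real.sqrt (π / ((1 / (4 * ℓ ^ 30)) / 2)) ≤ 1856 * ℓ ^ 1053 := by
  have hℓ0 : 0 < ℓ := by linarith
  have hπ := Real.pi_lt_four
  have h30 : 0 < ℓ ^ 30 := by positivity
  have e1 : 4 / (1 / (4 * ℓ ^ 30)) = 16 * ℓ ^ 30 := by field_simp; ring
  have e2 : π / ((1 / (4 * ℓ ^ 30)) / 4) = 16 * π * ℓ ^ 30 := by field_simp; ring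
  have e3 : π / ((1 / (4 * ℓ ^ 30)) / 2) = 8 * π * ℓ ^ 30 := by field_simp; ring
  have hs1 : Real.sqrt (16 * π * ℓ ^ 30) ≤ 8 * ℓ ^ 15 := by
    rw [Real.sqrt_le_left (by positivity)]
    nlinarith
  have hs2 : Real.sqrt (8 * π * ℓ ^ 30) ≤ 6 * ℓ ^ 15 := by
    rw [Real.sqrt_le_left (by positivity)]
    nlinarith
  rw [e1, e2, e3]
  have hA2 : A ^ 2 ≤ 144 * ℓ ^ 1038 := by
    calc A ^ 2 ≤ (12 * ℓ ^ 519) ^ 2 := pow_le_pow_left₀ hA0 hA 2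
      _ = 144 * ℓ ^ 1038 := by ring
  have h45 : ℓ ^ 45 ≤ ℓ ^ 1053 := pow_le_pow_right₀ hℓ (by norm_num)
  calc 16 * ℓ ^ 30 * Real.sqrt (16 * π * ℓ ^ 30) + 2 * A ^ 2 * Real.sqrt (8 * π * ℓ ^ 30)
      ≤ 16 * ℓ ^ 30 * (8 * ℓ ^ 15) + 2 * (144 * ℓ ^ 1038) * (6 * ℓ ^ 15) := by
        gcongr
    _ = 128 * ℓ ^ 45 + 1728 * ℓ ^ 1053 := by ring
    _ ≤ 128 * ℓ ^ 1053 + 1728 * ℓ ^ 1053 := by linarith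
    _ = 1856 * ℓ ^ 1053 := by ring

omit [NeZero D] in
/-- The outer half-lines: `3e·k²·e^{−𝓛¹⁰/8}·1856𝓛¹⁰⁵³ ≤ e^{−𝓛¹⁰/16}` for `k ≤ (9/8)e^{𝓛}e^{𝓛⁹}`
(`k = Dp`, `D = e^{𝓛}`, `p ≤ 9P/8`), `𝓛 ≥ 64`. [cite: Zhang2022LandauSiegel, §6 (6.2) p. 32] -/
private theorem bound_outer {ℓ k : ℝ} (hℓ : 64 ≤ ℓ) (hk0 : 0 ≤ k)
    (hk : k ≤ 9 / 8 * Real.exp ℓ * Real.exp (ℓ ^ 9)) :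
    3 * Real.exp 1 * k ^ 2 * Real.exp (-(ℓ ^ 10 / 8)) * (1856 * ℓ ^ 1053) ≤
      Real.exp (-(ℓ ^ 10 / 16)) := by
  have hℓ0 : 0 ≤ ℓ := by linarith
  have h1053 : ℓ ^ 1053 ≤ Real.exp (1053 * ℓ) := by exact_mod_cast pow_le_exp_nat_mul hℓ0 1053
  have hk2 : k ^ 2 ≤ (9 / 8 * Real.exp ℓ * Real.exp (ℓ ^ 9)) ^ 2 := pow_le_pow_left₀ hk0 hk 2
  have hc : (3 : ℝ) * (9 / 8) ^ 2 * 1856 ≤ Real.exp 7047 := by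
    have := nat_le_exp 7047; push_cast at this; linarith
  have h8 : (64 : ℝ) ^ 8 ≤ ℓ ^ 8 := pow_le_pow_left₀ (by norm_num) hℓ 8
  calc 3 * Real.exp 1 * k ^ 2 * Real.exp (-(ℓ ^ 10 / 8)) * (1856 * ℓ ^ 1053)
      ≤ 3 * Real.exp 1 * (9 / 8 * Real.exp ℓ * Real.exp (ℓ ^ 9)) ^ 2 * Real.exp (-(ℓ ^ 10 / 8)) *
          (1856 * Real.exp (1053 * ℓ)) := by gcongr
    _ = (3 * (9 / 8) ^ 2 * 1856) * (Real.exp 1 * (Real.exp ℓ) ^ 2 * (Real.exp (ℓ ^ 9)) ^ 2 *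
          Real.exp (-(ℓ ^ 10 / 8)) * Real.exp (1053 * ℓ)) := by ring
    _ ≤ Real.exp 7047 * (Real.exp 1 * (Real.exp ℓ) ^ 2 * (Real.exp (ℓ ^ 9)) ^ 2 *
          Real.exp (-(ℓ ^ 10 / 8)) * Real.exp (1053 * ℓ)) := by gcongr
    _ = Real.exp (7047 + 1 + 2 * ℓ + 2 * ℓ ^ 9 + -(ℓ ^ 10 / 8) + 1053 * ℓ) := by
        simp only [Real.exp_add, ← Real.exp_nat_mul]; push_cast; ring
    _ ≤ Real.exp (-(ℓ ^ 10 / 16)) := by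
        rw [Real.exp_le_exp]
        have e9 : ℓ ^ 9 = ℓ ^ 8 * ℓ := by ring
        have e10 : ℓ ^ 10 = ℓ ^ 8 * ℓ * ℓ := by ring
        rw [e9, e10]
        have hA : 0 ≤ ℓ ^ 8 * ℓ * (ℓ - 64) := by
          have : 0 ≤ ℓ ^ 8 * ℓ := by positivity
          exact mul_nonneg this (by linarith)
        have hB : (64 : ℝ) ^ 8 * ℓ ≤ ℓ ^ 8 * ℓ := mul_le_mul_of_nonneg_right h8 hℓ0
        nlinarith

/-! ## §2. The outer half-lines `u = −1`, `|v| > 𝓛²⁰` -/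

/-- **"By a trivial bound for `ω₁(w)` and simple estimates, the integrals on the segments `u = −1`,
`|v| > 𝓛²⁰` contribute `≪ ε`"** (§6 p. 32, tex L1746), for the (6.2)-integrand of `χψ`: with the
uniform bound `|Z(s′,θ)| ≤ Gk²(|Im s′|+2)²` on `−1 ≤ Re s′ ≤ 0` (the tree's
`StripGrowth.exists_norm_Zfac_le`), `|tail| ≤ 3` (`norm_tailPc_le`, `N = P₁ ≥ 1`),
`|X^wω₁(w)/w| ≤ X⁻¹e^{1/4𝓛³⁰}e^{−v²/4𝓛³⁰}` (`X = P^z ≥ 1`): the integral over `|v| > 𝓛²⁰` is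
`≤ 3e·G·(Dp)²·e^{−𝓛¹⁰/8}·((4/β)√(π/(β/4)) + 2(|t|+2)²√(π/(β/2)))`, `β = 1/(4𝓛³⁰)`
(`gauss_tail_quad_le`). [cite: Zhang2022LandauSiegel, §6 (6.2) p. 32, tex L1746; §11 p. 65] -/
theorem norm_integral_outer_le {G : ℝ} (hG0 : 0 < G)
    (hG : ∀ (k : ℕ) [NeZero k] (θ : DirichletCharacter ℂ k) (s' : ℂ), -1 ≤ s'.re → s'.re ≤ 0 →
      ‖GammaFactor.Zfac θ s'‖ ≤ G * (k : ℝ) ^ 2 * (|s'.im| + 2) ^ 2)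
    (hD : 9 ≤ D) {s : ℂ} (hs : InRange112 D s) {z : ℝ} (hz : 0.5 ≤ z) :
    ‖∫ v in (Set.Ioc (-(ell D ^ 20)) (ell D ^ 20))ᶜ,
        integrandTail χ x (bigP D ^ z) (Skeleton.P1 D) s (((-1 : ℝ) : ℂ) + (v : ℂ) * I)‖ ≤
      3 * Real.exp 1 * G * ((D : ℝ) * x.p) ^ 2 *
        (Real.exp (-((1 / (4 * ell D ^ 30)) / 2) * (ell D ^ 20) ^ 2) *
          (4 / (1 / (4 * ell D ^ 30)) * Real.sqrt (π / ((1 / (4 * ell D ^ 30)) / 4)) +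
            2 * (|s.im| + 2) ^ 2 * Real.sqrt (π / ((1 / (4 * ell D ^ 30)) / 2)))) := by
  obtain ⟨hre, _⟩ := hs
  have hD2 : 2 ≤ D := le_trans (by norm_num) hD
  have hℓ := Section6TailBounds.two_le_ell hD
  have hℓ0 : 0 < ell D := by linarith
  have hP : 0 < bigP D := Real.exp_pos _
  have hP1' : (1 : ℝ) ≤ bigP D := Real.one_le_exp (pow_nonneg hℓ0.le 9)
  have hX : 0 < bigP D ^ z := Real.rpow_pos_of_pos hP z
  have hX1 : 1 ≤ bigP D ^ z := Real.one_le_rpow hP1' (by linarith)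
  obtain ⟨hP1one, _⟩ := one_le_P1_and_sqrt D
  set β : ℝ := 1 / (4 * ell D ^ 30) with hβ
  have hβ0 : 0 < β := by rw [hβ]; positivity
  have hβ1 : β ≤ 1 := by
    rw [hβ, div_le_one (by positivity)]
    have : (1 : ℝ) ≤ ell D ^ 30 := one_le_pow₀ (by linarith)
    linarith
  set V : ℝ := ell D ^ 20 with hV
  have hV0 : 0 ≤ V := by positivity
  set k : ℕ := D * x.p with hk
  have hkR : (k : ℝ) = (D : ℝ) * x.p := by rw [hk]; push_cast; ring
  set A : ℝ := |s.im| + 2 with hA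
  set F : ℝ → ℂ := fun v =>
    integrandTail χ x (bigP D ^ z) (Skeleton.P1 D) s (((-1 : ℝ) : ℂ) + (v : ℂ) * I) with hF
  set K : ℝ := 3 * Real.exp 1 * G * ((D : ℝ) * x.p) ^ 2 with hKdef
  have hK0 : 0 ≤ K := by rw [hKdef]; positivity
  -- pointwise majorant on `u = −1`
  have hpt : ∀ v : ℝ, ‖F v‖ ≤ K * ((|v| + A) ^ 2 * Real.exp (-β * v ^ 2)) := by
    intro v
    have hz1 : -1 ≤ (s + (((-1 : ℝ) : ℂ) + (v : ℂ) * I)).re := by norm_num [hre]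
    have hz2 : (s + (((-1 : ℝ) : ℂ) + (v : ℂ) * I)).re ≤ 0 := by norm_num [hre]
    have hZb := hG k (psiChi χ x) (s + (((-1 : ℝ) : ℂ) + (v : ℂ) * I)) hz1 hz2
    have him : |(s + (((-1 : ℝ) : ℂ) + (v : ℂ) * I)).im| + 2 ≤ |v| + A := by
      simp only [Complex.add_im, Complex.ofReal_im, Complex.mul_im, Complex.ofReal_re, Complex.I_im,
        Complex.I_re, mul_zero, mul_one, zero_add, add_zero, hA]
      have := abs_add_le s.im v
      linarith
    have him0 : 0 ≤ |(s + (((-1 : ℝ) : ℂ) + (v : ℂ) * I)).im| + 2 := by positivity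
    have hZb' : ‖Zpc χ x (s + (((-1 : ℝ) : ℂ) + (v : ℂ) * I))‖ ≤ G * (k : ℝ) ^ 2 * (|v| + A) ^ 2 := by
      refine hZb.trans ?_
      exact mul_le_mul_of_nonneg_left (pow_le_pow_left₀ him0 him 2) (by positivity)
    have hT : ‖tailPc χ x (Skeleton.P1 D) s (((-1 : ℝ) : ℂ) + (v : ℂ) * I)‖ ≤ 3 := by
      have h := norm_tailPc_le χ x hre hP1one (le_refl (-1 : ℝ)) v
      have h1 : Skeleton.P1 D ^ (1 / 2 + (-1 : ℝ)) ≤ 1 :=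
        Real.rpow_le_one_of_one_le_of_nonpos hP1one (by norm_num)
      linarith
    have hKb := norm_kern_neg_one_le (D := D) hX v
    rw [← hβ] at hKb
    have hXinv : (bigP D ^ z)⁻¹ * Real.exp β ≤ Real.exp 1 := by
      have h1 : (bigP D ^ z)⁻¹ ≤ 1 := inv_le_one_of_one_le₀ hX1
      have h2 : Real.exp β ≤ Real.exp 1 := Real.exp_le_exp.mpr hβ1
      calc (bigP D ^ z)⁻¹ * Real.exp β ≤ 1 * Real.exp 1 :=
            mul_le_mul h1 h2 (Real.exp_pos _).le zero_le_one
        _ = Real.exp 1 := one_mul _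
    have hKb' : ‖kern D (bigP D ^ z) (((-1 : ℝ) : ℂ) + (v : ℂ) * I)‖ ≤
        Real.exp 1 * Real.exp (-β * v ^ 2) :=
      hKb.trans (mul_le_mul_of_nonneg_right hXinv (Real.exp_pos _).le)
    calc ‖F v‖
        = ‖Zpc χ x (s + (((-1 : ℝ) : ℂ) + (v : ℂ) * I))‖ *
          ‖tailPc χ x (Skeleton.P1 D) s (((-1 : ℝ) : ℂ) + (v : ℂ) * I)‖ *
          ‖kern D (bigP D ^ z) (((-1 : ℝ) : ℂ) + (v : ℂ) * I)‖ := by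
          simp only [hF, integrandTail, norm_mul]
      _ ≤ (G * (k : ℝ) ^ 2 * (|v| + A) ^ 2) * 3 * (Real.exp 1 * Real.exp (-β * v ^ 2)) := by
        gcongr
      _ = K * ((|v| + A) ^ 2 * Real.exp (-β * v ^ 2)) := by rw [hKdef, hkR]; ring
  -- integrate the majorant over `|v| > V`
  set S : Set ℝ := (Set.Ioc (-V) V)ᶜ with hS
  have hgi : Integrable fun v : ℝ => K * ((|v| + A) ^ 2 * Real.exp (-β * v ^ 2)) :=
    (integrable_absAddSq_mul_gauss hβ0 A).const_mul K
  have h1 : ‖∫ v in S, F v‖ ≤ ∫ v in S, K * ((|v| + A) ^ 2 * Real.exp (-β * v ^ 2)) :=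
    norm_integral_le_of_norm_le hgi.integrableOn (ae_of_all _ fun v => hpt v)
  have h2 : ∫ v in S, K * ((|v| + A) ^ 2 * Real.exp (-β * v ^ 2)) =
      K * ∫ v in S, (|v| + A) ^ 2 * Real.exp (-β * v ^ 2) := integral_const_mul _ _
  have h3 := gauss_tail_quad_le hβ0 A hV0
  rw [← hS] at h3
  calc ‖∫ v in S, F v‖ ≤ K * ∫ v in S, (|v| + A) ^ 2 * Real.exp (-β * v ^ 2) := by rw [← h2]; exact h1
    _ ≤ K * (Real.exp (-(β / 2) * V ^ 2) *
          (4 / β * Real.sqrt (π / (β / 4)) + 2 * A ^ 2 * Real.sqrt (π / (β / 2)))) :=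
        mul_le_mul_of_nonneg_left h3 hK0

/-! ## §3. The window `|v| ≤ 𝓛²⁰` moved to `u = −𝓛⁹` -/

/-- **The window `u = −1`, `|v| ≤ 𝓛²⁰` of (6.2) for `χψ` is `≤ 3e^{−𝓛¹⁰/8}`** (§6 p. 32: the
contour moved to `u = −𝓛⁹` with the two horizontal connecting segments): by `rect_integrandTail`
the window integral is the sum of the three inner segment integrals; on them
`norm_integrandTail_inner_le` gives `12√P₁e^{𝓛u}e^{(u²−v²)/4𝓛³⁰}`, i.e. `≤ 12√P₁e^{1/4−𝓛¹⁰/4}` on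
the horizontals (`|v| = 𝓛²⁰`, `u² ≤ 𝓛¹⁸`) and `≤ 12√P₁e^{−𝓛¹⁰}e^{1/4}` on `u = −𝓛⁹`; lengths
`𝓛⁹ − 1` and `2𝓛²⁰`; `√P₁ = e^{0.252𝓛⁹}`; `𝓛 ≥ 64`.
[cite: Zhang2022LandauSiegel, §6 (6.2) pp. 31–32, tex L1735–1754; §11 p. 65] -/
theorem norm_window_le (hD9 : 9 ≤ D) (hL64 : 64 ≤ ell D) (hp : χ.IsPrimitive) {s : ℂ}
    (hs : InRange112 D s) {z : ℝ} (hz1 : 0.5 ≤ z) :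
    ‖∫ v in (-(ell D ^ 20))..(ell D ^ 20),
        integrandTail χ x (bigP D ^ z) (Skeleton.P1 D) s (((-1 : ℝ) : ℂ) + (v : ℂ) * I)‖ ≤
      3 * Real.exp (-(ell D ^ 10 / 8)) := by
  have hL5 : 5 ≤ ell D := by linarith
  have hP : 0 < bigP D := Real.exp_pos _
  have hX : 0 < bigP D ^ z := Real.rpow_pos_of_pos hP z
  obtain ⟨_, hsqrt⟩ := one_le_P1_and_sqrt D
  -- the analytic inputs: the three-sided contour and the pointwise bound on the inner segments
  have hid := rect_integrandTail χ x hD9 hs hX (Skeleton.P1 D)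
  have hinner : ∀ u v : ℝ, -(ell D ^ 9) ≤ u → u ≤ -1 → |v| ≤ ell D ^ 20 →
      ‖integrandTail χ x (bigP D ^ z) (Skeleton.P1 D) s ((u : ℂ) + (v : ℂ) * I)‖ ≤
        12 * Real.sqrt (Skeleton.P1 D) * Real.exp (ell D * u) *
          Real.exp ((u ^ 2 - v ^ 2) / (4 * ell D ^ 30)) :=
    fun u v hu1 hu2 hv => norm_integrandTail_inner_le χ x hD9 hL5 hp hs hz1 hu1 hu2 hv
  -- abbreviations
  set ℓ : ℝ := ell D with hℓdef
  set F : ℂ → ℂ := integrandTail χ x (bigP D ^ z) (Skeleton.P1 D) s with hF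
  have hℓ1 : 1 ≤ ℓ := by linarith
  have hL1 : 1 ≤ ℓ ^ 9 := one_le_pow₀ hℓ1
  have hV0 : 0 ≤ ℓ ^ 20 := by positivity
  -- the Gaussian factors on the inner segments
  have hΛ : 0 < 4 * ℓ ^ 30 := by positivity
  have h18 : ℓ ^ 18 ≤ ℓ ^ 30 := pow_le_pow_right₀ hℓ1 (by norm_num)
  have hgauss_h : ∀ u v : ℝ, -(ℓ ^ 9) ≤ u → u ≤ -1 → |v| = ℓ ^ 20 →
      (u ^ 2 - v ^ 2) / (4 * ℓ ^ 30) ≤ 1 / 4 - ℓ ^ 10 / 4 := by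
    intro u v hu1 hu2 hv
    rw [div_le_iff₀ hΛ]
    have hv2 : v ^ 2 = (ℓ ^ 20) ^ 2 := by rw [← sq_abs, hv]
    have hu2' : u ^ 2 ≤ (ℓ ^ 9) ^ 2 := sq_le_sq' hu1 (by linarith)
    have e40 : (1 / 4 - ℓ ^ 10 / 4) * (4 * ℓ ^ 30) = ℓ ^ 30 - ℓ ^ 40 := by ring
    have e18 : (ℓ ^ 9) ^ 2 = ℓ ^ 18 := by ring
    have e40' : (ℓ ^ 20) ^ 2 = ℓ ^ 40 := by ring
    rw [e40, hv2, e40']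
    rw [e18] at hu2'
    linarith
  have hgauss_v : ∀ v : ℝ, ((-(ℓ ^ 9)) ^ 2 - v ^ 2) / (4 * ℓ ^ 30) ≤ 1 / 4 := by
    intro v
    rw [div_le_iff₀ hΛ]
    have e18 : (-(ℓ ^ 9)) ^ 2 = ℓ ^ 18 := by ring
    rw [e18]
    nlinarith [sq_nonneg v]
  -- pointwise bounds on the three inner segments
  set Mh : ℝ := 12 * Real.sqrt (Skeleton.P1 D) * 1 * Real.exp (1 / 4 - ℓ ^ 10 / 4) with hMh
  set Mv : ℝ := 12 * Real.sqrt (Skeleton.P1 D) * Real.exp (ℓ * -(ℓ ^ 9)) * Real.exp (1 / 4)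
    with hMv
  have hMh0 : 0 ≤ Mh := by positivity
  have hMv0 : 0 ≤ Mv := by positivity
  have h12 : 0 ≤ 12 * Real.sqrt (Skeleton.P1 D) := by positivity
  have hptH : ∀ u : ℝ, -(ℓ ^ 9) ≤ u → u ≤ -1 → ∀ v : ℝ, |v| = ℓ ^ 20 →
      ‖F ((u : ℂ) + (v : ℂ) * I)‖ ≤ Mh := by
    intro u hu1 hu2 v hv
    refine (hinner u v hu1 hu2 hv.le).trans ?_
    rw [hMh]
    have e1 : Real.exp (ℓ * u) ≤ 1 := by
      rw [Real.exp_le_one_iff]; nlinarith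
    have e2 : Real.exp ((u ^ 2 - v ^ 2) / (4 * ℓ ^ 30)) ≤ Real.exp (1 / 4 - ℓ ^ 10 / 4) :=
      Real.exp_le_exp.mpr (hgauss_h u v hu1 hu2 hv)
    exact mul_le_mul (mul_le_mul_of_nonneg_left e1 h12) e2 (Real.exp_pos _).le (by positivity)
  have hptV : ∀ v : ℝ, |v| ≤ ℓ ^ 20 → ‖F (((-(ℓ ^ 9) : ℝ) : ℂ) + (v : ℂ) * I)‖ ≤ Mv := by
    intro v hv
    refine (hinner (-(ℓ ^ 9)) v (le_refl _) (by linarith) hv).trans ?_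
    rw [hMv]
    have e2 : Real.exp (((-(ℓ ^ 9)) ^ 2 - v ^ 2) / (4 * ℓ ^ 30)) ≤ Real.exp (1 / 4) :=
      Real.exp_le_exp.mpr (hgauss_v v)
    exact mul_le_mul_of_nonneg_left e2 (by positivity)
  -- the three inner segment integrals
  have hH1 : ‖∫ u in (-1 : ℝ)..(-(ℓ ^ 9)), F ((u : ℂ) + ((-(ℓ ^ 20) : ℝ) : ℂ) * I)‖ ≤
      Mh * (ℓ ^ 9 - 1) := by
    have h := intervalIntegral.norm_integral_le_of_norm_le_const (a := (-1 : ℝ)) (b := -(ℓ ^ 9))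
      (f := fun u : ℝ => F ((u : ℂ) + ((-(ℓ ^ 20) : ℝ) : ℂ) * I)) (C := Mh) ?_
    · have habs : |-(ℓ ^ 9) - (-1 : ℝ)| = ℓ ^ 9 - 1 := by rw [abs_of_nonpos (by linarith)]; ring
      rwa [habs] at h
    · intro u hu
      rw [Set.uIoc_of_ge (by linarith), Set.mem_Ioc] at hu
      exact hptH u hu.1.le hu.2 _ (by rw [abs_neg, abs_of_nonneg hV0])
  have hH2 : ‖∫ u in (-(ℓ ^ 9))..(-1 : ℝ), F ((u : ℂ) + ((ℓ ^ 20 : ℝ) : ℂ) * I)‖ ≤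
      Mh * (ℓ ^ 9 - 1) := by
    have h := intervalIntegral.norm_integral_le_of_norm_le_const (a := -(ℓ ^ 9)) (b := (-1 : ℝ))
      (f := fun u : ℝ => F ((u : ℂ) + ((ℓ ^ 20 : ℝ) : ℂ) * I)) (C := Mh) ?_
    · have habs : |(-1 : ℝ) - -(ℓ ^ 9)| = ℓ ^ 9 - 1 := by rw [abs_of_nonneg (by linarith)]; ring
      rwa [habs] at h
    · intro u hu
      rw [Set.uIoc_of_le (by linarith), Set.mem_Ioc] at hu
      exact hptH u hu.1.le hu.2 _ (abs_of_nonneg hV0)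
  have hVert : ‖∫ v in (-(ℓ ^ 20))..(ℓ ^ 20), F (((-(ℓ ^ 9) : ℝ) : ℂ) + (v : ℂ) * I)‖ ≤
      Mv * (2 * ℓ ^ 20) := by
    have h := intervalIntegral.norm_integral_le_of_norm_le_const (a := -(ℓ ^ 20)) (b := ℓ ^ 20)
      (f := fun v : ℝ => F (((-(ℓ ^ 9) : ℝ) : ℂ) + (v : ℂ) * I)) (C := Mv) ?_
    · have habs : |ℓ ^ 20 - -(ℓ ^ 20)| = 2 * ℓ ^ 20 := by rw [abs_of_nonneg (by linarith)]; ring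
      rwa [habs] at h
    · intro v hv
      rw [Set.uIoc_of_le (by linarith), Set.mem_Ioc] at hv
      exact hptV v (abs_le.mpr ⟨hv.1.le, hv.2⟩)
  -- ε-bookkeeping
  have hεh : Mh * ℓ ^ 9 ≤ Real.exp (-(ℓ ^ 10 / 8)) := by
    rw [hMh, hsqrt, mul_one, mul_comm]
    exact bound_horizontal hL64
  have hεv : Mv * (2 * ℓ ^ 20) ≤ Real.exp (-(ℓ ^ 10 / 8)) := by
    rw [hMv, hsqrt]
    have := bound_vertical hL64
    linarith
  have hL' : Mh * (ℓ ^ 9 - 1) ≤ Mh * ℓ ^ 9 :=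
    mul_le_mul_of_nonneg_left (sub_le_self _ zero_le_one) hMh0
  -- the window via the contour identity
  have e1 : ‖∫ v in (-(ℓ ^ 20))..(ℓ ^ 20), F (((-1 : ℝ) : ℂ) + (v : ℂ) * I)‖ =
      ‖I * ∫ v in (-(ℓ ^ 20))..(ℓ ^ 20), F (((-1 : ℝ) : ℂ) + (v : ℂ) * I)‖ := by
    rw [norm_mul, Complex.norm_I, one_mul]
  rw [e1, hid]
  calc _ ≤ ‖(∫ u in (-1 : ℝ)..(-(ℓ ^ 9)), F ((u : ℂ) + ((-(ℓ ^ 20) : ℝ) : ℂ) * I)) +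
          I * (∫ v in (-(ℓ ^ 20))..(ℓ ^ 20), F (((-(ℓ ^ 9) : ℝ) : ℂ) + (v : ℂ) * I))‖ +
        ‖∫ u in (-(ℓ ^ 9))..(-1 : ℝ), F ((u : ℂ) + ((ℓ ^ 20 : ℝ) : ℂ) * I)‖ := norm_add_le _ _
    _ ≤ (‖∫ u in (-1 : ℝ)..(-(ℓ ^ 9)), F ((u : ℂ) + ((-(ℓ ^ 20) : ℝ) : ℂ) * I)‖ +
          ‖I * (∫ v in (-(ℓ ^ 20))..(ℓ ^ 20), F (((-(ℓ ^ 9) : ℝ) : ℂ) + (v : ℂ) * I))‖) +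
        ‖∫ u in (-(ℓ ^ 9))..(-1 : ℝ), F ((u : ℂ) + ((ℓ ^ 20 : ℝ) : ℂ) * I)‖ := by
        gcongr; exact norm_add_le _ _
    _ ≤ (Mh * (ℓ ^ 9 - 1) + Mv * (2 * ℓ ^ 20)) + Mh * (ℓ ^ 9 - 1) := by
        rw [norm_mul, Complex.norm_I, one_mul]
        exact add_le_add (add_le_add hH1 hVert) hH2
    _ ≤ 3 * Real.exp (-(ℓ ^ 10 / 8)) := by linarith

/-! ## §4. (6.2) for `χψ` -/

/-- **Sub-step (d) of `Z22:§11.u024` PROVED — `TailSmall11` holds** (`c = 1/16`, `D ≥ ⌈e⁶⁴⌉`): for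
`ψ ∈ Ψ`, `σ = 1/2`, `|t − 2πt₀| < 𝓛₁`, `0.5 ≤ z ≤ 0.504`,
`‖(1/2πi)∫_{(−1)} Z(s+w,χψ)(Σ_{n≥P₁}χψ̄(n)n^{−(1−s−w)})P^{zw}ω₁(w)dw/w‖ ≤ C·exp{−𝓛¹⁰/16}` — the
§6 argument for (6.2) (pp. 31–32) carried out for `χψ (mod Dp)`: split the line `u = −1` at
`|v| = 𝓛²⁰`; the outer half-lines by `norm_integral_outer_le` with every `D`-dependent prefactor
(`(Dp)² ≤ 2D²P²`, powers of `𝓛`) absorbed into `exp{−𝓛¹⁰/16}` (`bound_outer`); the window by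
`norm_window_le`. [cite: Zhang2022LandauSiegel, §6 (6.2) pp. 31–32, tex L1729–1754; §11 Lemma 11.2 (proof) p. 65] -/
theorem tailSmall11_holds : TailSmall11 := by
  obtain ⟨G, hG0, hG⟩ := StripGrowth.exists_norm_Zfac_le (A := 1) le_rfl
  have hG' : ∀ (k : ℕ) [NeZero k] (θ : DirichletCharacter ℂ k) (s' : ℂ), -1 ≤ s'.re → s'.re ≤ 0 →
      ‖GammaFactor.Zfac θ s'‖ ≤ G * (k : ℝ) ^ 2 * (|s'.im| + 2) ^ 2 := by
    intro k _ θ s' h1 h2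
    have h := hG k θ s' (by simpa using h1) h2
    have e : (|s'.im| + ((1 : ℕ) : ℝ) + 1) ^ (1 + 1) = (|s'.im| + 2) ^ 2 := by norm_num; ring
    rw [e] at h
    exact h
  refine ⟨1 / 16, by norm_num, G + 3, ⌈Real.exp 64⌉₊, fun D _ χ hD hq hp x s hs z hz1 hz2 => ?_⟩
  -- parameters
  have hexp : Real.exp 64 ≤ D := le_trans (Nat.le_ceil _) (by exact_mod_cast hD)
  have hL64 : 64 ≤ ell D := (Real.le_log_iff_exp_le (lt_of_lt_of_le (Real.exp_pos _) hexp)).mpr hexp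
  have hD9 : 9 ≤ D := by
    have h9 : (9 : ℝ) ≤ Real.exp 64 := by have := Real.add_one_le_exp (64 : ℝ); linarith
    exact_mod_cast h9.trans hexp
  have hD2 : 2 ≤ D := le_trans (by norm_num) hD9
  have hsR := hs
  obtain ⟨hre, him⟩ := hs
  have hr61 := inRange61_of_inRange112 hD9 hsR
  have hP : 0 < bigP D := Real.exp_pos _
  have hX : 0 < bigP D ^ z := Real.rpow_pos_of_pos hP z
  obtain ⟨hp1, hp2⟩ := Section6TailBounds.p_range hD9 x
  have hD0 : (0 : ℝ) < D := by exact_mod_cast Nat.pos_of_ne_zero (NeZero.ne D)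
  have hDexp : (D : ℝ) = Real.exp (ell D) := by rw [ell, Real.exp_log hD0]
  obtain ⟨htlo, hthi⟩ := Section6TailBounds.im_add_range hD9 hr61 (v := 0)
    (by rw [abs_zero]; positivity)
  rw [add_zero] at htlo hthi
  have h519 : (2 : ℝ) ≤ ell D ^ 519 := Section6TailBounds.two_le_ell_pow hD9 (by norm_num)
  -- the analytic inputs: the outer half-lines, the window, integrability on `u = −1`
  have hout := norm_integral_outer_le χ x hG0 hG' hD9 hsR hz1
  have hwindow := norm_window_le χ x hD9 hL64 hp hsR hz1
  have hint : Integrable fun v : ℝ =>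
      integrandTail χ x (bigP D ^ z) (Skeleton.P1 D) s (((-1 : ℝ) : ℂ) + (v : ℂ) * I) :=
    integrable_integrandTail χ x hD2 hre hX (Skeleton.P1 D)
  unfold vline
  -- abbreviations
  set ℓ : ℝ := ell D with hℓdef
  set F : ℂ → ℂ := integrandTail χ x (bigP D ^ z) (Skeleton.P1 D) s with hF
  have hℓ0 : 0 < ℓ := by linarith
  have hℓ1 : 1 ≤ ℓ := by linarith
  have hV0 : 0 ≤ ℓ ^ 20 := by positivity
  -- the outer half-lines are `≤ G·e^{−ℓ¹⁰/16}`
  have hk : (D : ℝ) * x.p ≤ 9 / 8 * Real.exp ℓ * Real.exp (ℓ ^ 9) := by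
    have hPdef : bigP D = Real.exp (ℓ ^ 9) := by rw [bigP]
    rw [← hDexp, ← hPdef]
    calc (D : ℝ) * x.p ≤ D * (9 / 8 * bigP D) := mul_le_mul_of_nonneg_left hp2 hD0.le
      _ = 9 / 8 * D * bigP D := by ring
  have htA : |s.im| + 2 ≤ 12 * ℓ ^ 519 := by
    rw [abs_of_pos (by linarith)]
    linarith
  have hV2 : (ℓ ^ 20) ^ 2 = ℓ ^ 40 := by ring
  have hεo : 3 * Real.exp 1 * G * ((D : ℝ) * x.p) ^ 2 *
      (Real.exp (-((1 / (4 * ℓ ^ 30)) / 2) * (ℓ ^ 20) ^ 2) *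
        (4 / (1 / (4 * ℓ ^ 30)) * Real.sqrt (π / ((1 / (4 * ℓ ^ 30)) / 4)) +
          2 * (|s.im| + 2) ^ 2 * Real.sqrt (π / ((1 / (4 * ℓ ^ 30)) / 2)))) ≤
      G * Real.exp (-(ℓ ^ 10 / 16)) := by
    have hbr := bracket_le hℓ1 (by positivity) htA
    have hg : Real.exp (-((1 / (4 * ℓ ^ 30)) / 2) * (ℓ ^ 20) ^ 2) = Real.exp (-(ℓ ^ 10 / 8)) := by
      congr 1; rw [hV2]; field_simp; ring
    rw [hg]
    have hk0 : 0 ≤ (D : ℝ) * x.p := by positivity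
    have hbo := bound_outer hL64 hk0 hk
    have hc0 : 0 ≤ 3 * Real.exp 1 * G * ((D : ℝ) * x.p) ^ 2 * Real.exp (-(ℓ ^ 10 / 8)) := by
      positivity
    calc 3 * Real.exp 1 * G * ((D : ℝ) * x.p) ^ 2 * (Real.exp (-(ℓ ^ 10 / 8)) *
          (4 / (1 / (4 * ℓ ^ 30)) * Real.sqrt (π / ((1 / (4 * ℓ ^ 30)) / 4)) +
            2 * (|s.im| + 2) ^ 2 * Real.sqrt (π / ((1 / (4 * ℓ ^ 30)) / 2))))
        = 3 * Real.exp 1 * G * ((D : ℝ) * x.p) ^ 2 * Real.exp (-(ℓ ^ 10 / 8)) *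
            (4 / (1 / (4 * ℓ ^ 30)) * Real.sqrt (π / ((1 / (4 * ℓ ^ 30)) / 4)) +
              2 * (|s.im| + 2) ^ 2 * Real.sqrt (π / ((1 / (4 * ℓ ^ 30)) / 2))) := by ring
      _ ≤ 3 * Real.exp 1 * G * ((D : ℝ) * x.p) ^ 2 * Real.exp (-(ℓ ^ 10 / 8)) *
            (1856 * ℓ ^ 1053) := mul_le_mul_of_nonneg_left hbr hc0
      _ = G * (3 * Real.exp 1 * ((D : ℝ) * x.p) ^ 2 * Real.exp (-(ℓ ^ 10 / 8)) *
            (1856 * ℓ ^ 1053)) := by ring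
      _ ≤ G * Real.exp (-(ℓ ^ 10 / 16)) := mul_le_mul_of_nonneg_left hbo hG0.le
  -- `ε`-monotonicity
  have h10pos : 0 ≤ ℓ ^ 10 := by positivity
  have hε8 : Real.exp (-(ℓ ^ 10 / 8)) ≤ Real.exp (-(1 / 16) * ℓ ^ 10) := by
    rw [Real.exp_le_exp]; nlinarith
  have hε16 : Real.exp (-(ℓ ^ 10 / 16)) = Real.exp (-(1 / 16) * ℓ ^ 10) := by
    ring_nf
  -- assemble: `vline F (−1) = (1/2π)·(∫_{window} + ∫_{outer})`
  have hsplit := integral_add_compl (μ := volume) (s := Set.Ioc (-(ℓ ^ 20)) (ℓ ^ 20))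
    measurableSet_Ioc hint
  have hwin : ∫ v in Set.Ioc (-(ℓ ^ 20)) (ℓ ^ 20), F (((-1 : ℝ) : ℂ) + (v : ℂ) * I) =
      ∫ v in (-(ℓ ^ 20))..(ℓ ^ 20), F (((-1 : ℝ) : ℂ) + (v : ℂ) * I) :=
    (intervalIntegral.integral_of_le (by linarith)).symm
  have hnormC : ‖(1 / (2 * π) : ℂ)‖ ≤ 1 := by
    have hπ := Real.pi_gt_three
    rw [show (1 / (2 * π) : ℂ) = ((1 / (2 * π) : ℝ) : ℂ) by push_cast; ring, Complex.norm_real,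
      Real.norm_of_nonneg (by positivity)]
    rw [div_le_one (by positivity)]; linarith
  calc ‖(1 / (2 * π) : ℂ) * ∫ v : ℝ, F (((-1 : ℝ) : ℂ) + (v : ℂ) * I)‖
      = ‖(1 / (2 * π) : ℂ)‖ * ‖∫ v : ℝ, F (((-1 : ℝ) : ℂ) + (v : ℂ) * I)‖ := norm_mul _ _
    _ ≤ 1 * ‖∫ v : ℝ, F (((-1 : ℝ) : ℂ) + (v : ℂ) * I)‖ :=
        mul_le_mul_of_nonneg_right hnormC (norm_nonneg _)
    _ = ‖(∫ v in Set.Ioc (-(ℓ ^ 20)) (ℓ ^ 20), F (((-1 : ℝ) : ℂ) + (v : ℂ) * I)) +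
          ∫ v in (Set.Ioc (-(ℓ ^ 20)) (ℓ ^ 20))ᶜ, F (((-1 : ℝ) : ℂ) + (v : ℂ) * I)‖ := by
        rw [one_mul, hsplit]
    _ ≤ ‖∫ v in Set.Ioc (-(ℓ ^ 20)) (ℓ ^ 20), F (((-1 : ℝ) : ℂ) + (v : ℂ) * I)‖ +
          ‖∫ v in (Set.Ioc (-(ℓ ^ 20)) (ℓ ^ 20))ᶜ, F (((-1 : ℝ) : ℂ) + (v : ℂ) * I)‖ :=
        norm_add_le _ _
    _ ≤ 3 * Real.exp (-(ℓ ^ 10 / 8)) + G * Real.exp (-(ℓ ^ 10 / 16)) := by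
        rw [hwin]
        exact add_le_add hwindow (hout.trans hεo)
    _ ≤ 3 * Real.exp (-(1 / 16) * ℓ ^ 10) + G * Real.exp (-(1 / 16) * ℓ ^ 10) := by
        rw [hε16]; gcongr
    _ = (G + 3) * Real.exp (-(1 / 16) * ℓ ^ 10) := by ring

end BlockDFinal

end Literature.NumberTheory.LFunctions.Zhang2022.Section11AFE
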